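import Literature.MathematicalPhysics.QuantumFieldTheory.Balaban1983to89.B9Thm37KLetterDir

/-!
# `Balaban1983to89.B9RWSums343HolderGpDir` — the (3.43) Hölder members of Theorem 3.7's sum G′(U) OVER THE DIRECTION LETTERS (ruling R1′):
# n06-k's `B9RWSums343HolderGp.holder343_of_local37` with `Identities₂` + `DirSupSq37`, `hR_dir`, `fixedPoint_dir`∕`fixedPointT_dir`, `KoptDir` and
# `HolderV37Dir` — engine re-thread (A3), file 5

T. Bałaban, *Propagators for lattice gauge theories in a background field*, Commun. Math. Phys. **99** (1985) 389–434
[`Balaban1985BackgroundPropagators`, "B9"], Thm 3.7 (3.87)–(3.90) pp. 408–410, (3.43) p. 398, (3.42) p. 397, (3.100) p. 413; T. Bałaban, *Propagators and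
renormalization transformations for lattice gauge theories. II*, Commun. Math. Phys. **96** (1984) 223–250 [`Balaban1984PropagatorsII`, "[4]"], (2.52)–(2.55)
p. 232, Lemma 2.1 p. 234.

statement-level skeleton of published theorems with citation tags; proofs where landed; nothing here is a claim about the
Yang–Mills mass gap

WHY THIS FILE (cell `pub-ymgap`, Track A node N06 [B9], rows 18–19; dag-n06-d g10 «re-thread the engine over Identities₂»; seat `pub-ymgap-dag-n06-c` g10).
v1 reads R′ = Σ_□ (P_□∇_U + C_□)G′_□M_h through `Identities.hP ∕ hC` (`h389_of_342`) and V through `𝔬.Dstar U ∘ₗ 𝔬.Pt U i + 𝔬.Ct U i`; here R′ = `RprimeDir`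
(K-letter `KopDir = Σ_μ P_{□,μ}∇_{U,μ} + C_□`, majorised by `B9Thm37KLetterDir.hR_dir` from Cor. 3.6's entries, the per-direction entries `DirSupSq37` and
`Identities₂`), V's cube terms carry `KoptDir`, and the probe schema is `HolderV37Dir`.  New hypothesis: `hT : DirSupSq37 𝔬 𝔡 R H U`.  Everything else verbatim.

HONEST SCOPE.  Majorant bookkeeping over n06-k's landed Hölder calculus (`leftMember_of_localLegs`, `rightMember_of_localLegs`); legs and probe terms are
HYPOTHESES (schemas); nothing of [B9] asserted; COUNT-NEUTRAL; N06 NOT discharged; one finite lattice programme — nothing continuum, nothing about OS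
positivity or the mass gap.
-/

namespace Literature.MathematicalPhysics.QuantumFieldTheory.Balaban1983to89.B9RWSums343HolderGpDir

open Finset B6RandomWalk B6RandomWalkHom B9Thm37Sum B9Thm34Ext B9Thm37Glue B9Thm37Whole B9Cor38Whole
open B9RWSums343to347Whole B9RWSums346Schur B9Thm37GlueCor36 B9RWSums343Holder B9RWSums343HolderGp B9RWSums346SecondDiff
open B9RWSums346SecondDiffGp B9Thm37WholeDir B9Thm37KLetterDir

noncomputable section

section GpSide

variable {g : B9.Geometry} [Fintype g.Site] [DecidableEq g.Site] {R : ℝ} {H : Prop} {B : B9.Backgrounds}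
variable {X Y ι PX PY Dir : Type} [Fintype Dir]

/-- ★★ **THE (3.43) HÖLDER MEMBERS OF THEOREM 3.7 FOR THE SUM G′(U) OF (3.90), OVER THE DIRECTION LETTERS** — `B9RWSums343HolderGp.holder343_of_local37`
with `Identities₂` + `DirSupSq37` (the (3.89) majorant of `R′ = RprimeDir` by `hR_dir`, (3.88) by `fixedPoint_dir`, its transpose by `fixedPointT_dir` with
`V = Σ_□ h_□G′_□·KoptDir`) and the probe schema `HolderV37Dir`; statement, constants (`holderConst`) and proof otherwise verbatim.
[cite: Balaban1985BackgroundPropagators, Thm 3.7 (3.87)–(3.90) pp.408–410 + (3.43) p.398 + (3.42) p.397 + (3.100) p.413; Balaban1984PropagatorsII, (2.52)–(2.55) p.232 + Lemma 2.1 p.234] -/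
theorem holder343_of_local37_dir [Fintype X] [DecidableEq X] [Fintype Y] [DecidableEq Y] [Fintype ι] [Fintype PX]
    [DecidableEq PX] [Fintype PY] [DecidableEq PY]
    (𝔬 : Ops g B X Y ι) (𝔡 : DirOps37 𝔬 Dir) (𝔩 : DirLetters37 𝔬 Dir) (𝔭 : HolderProbes g B X Y PX PY) (R : ℝ) (H : Prop) (d : ℕ)
    (δ₀ α ρ B₀ N N' Cℓ NH C δ : ℝ) (κ : Sizes) (SH : ι → Finset g.Site) (Bl BV : ℝ → ℝ) (U : B.Cfg)
    (hB₀ : 0 ≤ B₀) (hδ₀ : 0 ≤ δ₀) (hα : 0 ≤ α) (hα1 : α ≤ 1) (hN' : 0 ≤ N') (hNH : 0 ≤ NH) (hC : 0 ≤ C) (hδ : 0 ≤ δ)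
    (hδle : δ ≤ (1 - α) * δ₀)
    (hs : StaticOK 𝔬 ρ N N' Cℓ κ) (hκ : κ.Nonneg) (hcntH : ∀ a : g.Site, (∑ i, if a ∈ SH i then (1 : ℝ) else 0) ≤ NH)
    (hBl : ∀ β, 0 ≤ β → β < 1 → 0 ≤ Bl β) (hBV : ∀ β, 0 ≤ β → β < 1 → 0 ≤ BV β)
    (h261 : Ineq261 d (toB6 g R H) δ₀ α)
    (hq : N' * (B₀ * Real.exp (δ₀ * ρ) * (κ.kP + κ.kC)) * B6.c1 d δ₀ α ≤ 1 / 2)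
    (hl : Local342 𝔬 R H B₀ δ₀ U) (hT : DirSupSq37 𝔬 𝔡 R H U) (hi : Identities₂ 𝔬 𝔡 𝔩 R H U)
    (hL : HolderLegs37 𝔬 𝔭 R H SH Bl δ₀ U) (hV : HolderV37Dir 𝔬 𝔡 𝔩 𝔭 R H BV δ₀ U)
    (h2 : HasMajorantHom (g := toB6 g R H) 𝔬.blkY 𝔬.blk (𝔬.Gp U ∘ₗ 𝔬.Dstar U)
      (fun (a b : g.Site) => C * g.len a * Real.exp (-(δ * g.dist a b)))) :
    ∀ β : ℝ, 0 ≤ β → β < 1 →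
      HasMajorantHom (g := toB6 g R H) 𝔬.blk 𝔭.blkPY ((𝔭.ΦY U β ∘ₗ 𝔬.D U) ∘ₗ 𝔬.Gp U)
          (fun (a b : g.Site) => holderConst d δ₀ α NH N' C (Bl β) (BV β) * g.len a ^ (1 - β) *
            Real.exp (-(δ * g.dist a b))) ∧
        HasMajorantHom (g := toB6 g R H) 𝔬.blkY 𝔭.blkPX (𝔭.ΦX U β ∘ₗ (𝔬.Gp U ∘ₗ 𝔬.Dstar U))
          (fun (a b : g.Site) => holderConst d δ₀ α NH N' C (Bl β) (BV β) * g.len a ^ (1 - β) *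
            Real.exp (-(δ * g.dist a b))) := by
  intro β hβ0 hβ1
  have hlen : ∀ y : g.Site, 0 ≤ g.len y := fun y => (hs.lenpos y).le
  have hW : ∀ y : g.Site, 0 ≤ g.len y ^ (1 - β) := fun y => Real.rpow_nonneg (hlen y) _
  have htri : Triangle254 (toB6 g R H) := fun a b c => hs.tri a b c
  have hc1 : 0 ≤ B6.c1 d δ₀ α := c1_nonneg d δ₀ α
  have hk12 : 0 ≤ κ.kP + κ.kC := add_nonneg hκ.kP hκ.kC
  have hθ : 0 ≤ N' * (B₀ * Real.exp (δ₀ * ρ) * (κ.kP + κ.kC)) :=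
    mul_nonneg hN' (mul_nonneg (mul_nonneg hB₀ (Real.exp_nonneg _)) hk12)
  have hsmall : N' * (B₀ * Real.exp (δ₀ * ρ) * (κ.kP + κ.kC)) * B6.c1 d δ₀ α < 1 := by linarith
  have hb : 0 ≤ Bl β := hBl β hβ0 hβ1
  have hv : 0 ≤ BV β := hBV β hβ0 hβ1
  have hαδ₀ : 0 ≤ α * δ₀ := mul_nonneg hα hδ₀
  have hexp : ∀ a b : g.Site, Real.exp (-((1 - α) * δ₀ * g.dist a b)) ≤ Real.exp (-(δ * g.dist a b)) := fun a b =>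
    Real.exp_le_exp.mpr (neg_le_neg (mul_le_mul_of_nonneg_right hδle (hs.dnn a b)))
  -- (3.89) cube by cube, summed with N′: R′ has majorant N′B₀e^{δ₀ρ}(κ_P + κ_C)e^{−δ₀d}
  -- (3.89) cube by cube over the direction letters, summed with N′: R′ has majorant N′B₀e^{δ₀ρ}(κ_P + κ_C)e^{−δ₀d} (`hR_dir`)
  have hR : HasMajorant (g := toB6 g R H) 𝔬.blk (RprimeDir 𝔬 𝔡 𝔩 U)
      (fun (a b : g.Site) => N' * (B₀ * Real.exp (δ₀ * ρ) * (κ.kP + κ.kC)) * Real.exp (-(δ₀ * g.dist a b))) :=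
    hR_dir hB₀ hδ₀ hκ hs hl hT hi
  -- G′ = G′₀ + G′R′ ((3.88) and G′Δ′_a = I, `fixedPoint_dir`)
  have hfix : 𝔬.Gp U = (∑ i, mulOp (𝔬.h i) * 𝔬.Gsq U i * mulOp (𝔬.h i)) + 𝔬.Gp U * RprimeDir 𝔬 𝔡 𝔩 U :=
    fixedPoint_dir hi
  have eL := leftMember_of_localLegs (R := R) (H := H) 𝔬.blk 𝔭.blkPY d δ₀ α (N' * (B₀ * Real.exp (δ₀ * ρ) * (κ.kP + κ.kC)))
    (Bl β) NH (fun y => g.len y ^ (1 - β)) (fun i (a : g.Site) => if a ∈ SH i then (1 : ℝ) else 0) hb hNH hW hθ hδ₀ hα1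
    htri hs.refl hs.dnn h261 hsmall hcntH hfix hR (hL.left β hβ0 hβ1)
  -- the transposed (3.88): G′ = G′₀ + VG′, V = Σ_□ h_□G′_□(∇*Pᵗ_□ + Cᵗ_□)
  have hGT : 𝔬.Gp U = (∑ i, mulOp (𝔬.h i) * 𝔬.Gsq U i * mulOp (𝔬.h i)) +
      (∑ i, mulOp (𝔬.h i) * 𝔬.Gsq U i * KoptDir 𝔬 𝔡 𝔩 U i) * 𝔬.Gp U :=
    fixedPointT_dir hi
  have hsumD : (∑ i, mulOp (𝔬.h i) * 𝔬.Gsq U i * mulOp (𝔬.h i)) ∘ₗ 𝔬.Dstar U =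
      ∑ i, (mulOp (𝔬.h i) * 𝔬.Gsq U i * mulOp (𝔬.h i)) ∘ₗ 𝔬.Dstar U := by
    apply LinearMap.ext
    intro μ
    simp only [LinearMap.comp_apply, LinearMap.sum_apply]
  have hfixT : 𝔬.Gp U ∘ₗ 𝔬.Dstar U = (∑ i, (mulOp (𝔬.h i) * 𝔬.Gsq U i * mulOp (𝔬.h i)) ∘ₗ 𝔬.Dstar U) +
      (∑ i, mulOp (𝔬.h i) * 𝔬.Gsq U i * KoptDir 𝔬 𝔡 𝔩 U i) ∘ₗ (𝔬.Gp U ∘ₗ 𝔬.Dstar U) := by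
    conv_lhs => rw [hGT]
    rw [LinearMap.add_comp, Module.End.mul_eq_comp, LinearMap.comp_assoc, hsumD]
  -- Φ^X∘V summed with N′
  have hsumV : 𝔭.ΦX U β ∘ₗ (∑ i, mulOp (𝔬.h i) * 𝔬.Gsq U i * KoptDir 𝔬 𝔡 𝔩 U i) =
      ∑ i, 𝔭.ΦX U β ∘ₗ (mulOp (𝔬.h i) * 𝔬.Gsq U i * KoptDir 𝔬 𝔡 𝔩 U i) := by
    apply LinearMap.ext
    intro μ
    rw [LinearMap.comp_apply, LinearMap.sum_apply, LinearMap.sum_apply, map_sum]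
    rfl
  have hEV : HasMajorantHom (g := toB6 g R H) 𝔬.blk 𝔭.blkPX
      (𝔭.ΦX U β ∘ₗ ∑ i, mulOp (𝔬.h i) * 𝔬.Gsq U i * KoptDir 𝔬 𝔡 𝔩 U i)
      (fun (y y' : g.Site) => N' * BV β * (g.len y ^ (1 - β) * (g.len y')⁻¹) * Real.exp (-(δ₀ * g.dist y y'))) := by
    rw [hsumV]
    refine hasMajorantHom_mono (g := toB6 g R H) 𝔬.blk 𝔭.blkPX
      (hasMajorantHom_fintypeSum 𝔬.blk 𝔭.blkPX
        (fun i => 𝔭.ΦX U β ∘ₗ (mulOp (𝔬.h i) * 𝔬.Gsq U i * KoptDir 𝔬 𝔡 𝔩 U i)) _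
        (hV.probeV β hβ0 hβ1)) fun y y' => ?_
    have h3 : 0 ≤ BV β * (g.len y ^ (1 - β) * (g.len y')⁻¹) * Real.exp (-(δ₀ * g.dist y y')) :=
      mul_nonneg (mul_nonneg hv (mul_nonneg (hW y) (inv_nonneg.mpr (hlen y')))) (Real.exp_nonneg _)
    calc (∑ i, (if y' ∈ 𝔬.S' i then (1 : ℝ) else 0) * BV β * (g.len y ^ (1 - β) * (g.len y')⁻¹) *
            Real.exp (-(δ₀ * g.dist y y')))
        = (∑ i, if y' ∈ 𝔬.S' i then (1 : ℝ) else 0) *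
            (BV β * (g.len y ^ (1 - β) * (g.len y')⁻¹) * Real.exp (-(δ₀ * g.dist y y'))) := by
          rw [Finset.sum_mul]
          exact Finset.sum_congr rfl fun i _ => by ring
      _ ≤ N' * (BV β * (g.len y ^ (1 - β) * (g.len y')⁻¹) * Real.exp (-(δ₀ * g.dist y y'))) :=
          mul_le_mul_of_nonneg_right (hs.cnt' y') h3
      _ = N' * BV β * (g.len y ^ (1 - β) * (g.len y')⁻¹) * Real.exp (-(δ₀ * g.dist y y')) := by ring
  have eR := rightMember_of_localLegs (R := R) (H := H) 𝔬.blk 𝔬.blkY 𝔭.blkPX d δ₀ α δ (N' * BV β) (Bl β) NH C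
    (fun y => g.len y ^ (1 - β)) (fun y => g.len y) (fun i (a : g.Site) => if a ∈ SH i then (1 : ℝ) else 0) hb hNH hC
    (mul_nonneg hN' hv) hW hs.lenpos hδ hδle hαδ₀ htri hs.dnn h261 hcntH hfixT h2 hEV (hL.right β hβ0 hβ1)
  -- the two constants against `holderConst`
  have hK : 0 ≤ holderConst d δ₀ α NH N' C (Bl β) (BV β) := by
    unfold holderConst
    positivity
  refine ⟨hasMajorantHom_mono (g := toB6 g R H) 𝔬.blk 𝔭.blkPY eL fun a b => ?_,
    hasMajorantHom_mono (g := toB6 g R H) 𝔬.blkY 𝔭.blkPX eR fun a b => ?_⟩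
  · have hinv : (1 - N' * (B₀ * Real.exp (δ₀ * ρ) * (κ.kP + κ.kC)) * B6.c1 d δ₀ α)⁻¹ ≤ 2 := by
      rw [inv_le_comm₀ (by linarith) (by norm_num : (0 : ℝ) < 2)]
      linarith
    have hA0 : 0 ≤ NH * Bl β * B6.c1 d δ₀ α := mul_nonneg (mul_nonneg hNH hb) hc1
    have h1 : NH * Bl β * B6.c1 d δ₀ α * (1 - N' * (B₀ * Real.exp (δ₀ * ρ) * (κ.kP + κ.kC)) * B6.c1 d δ₀ α)⁻¹ ≤
        holderConst d δ₀ α NH N' C (Bl β) (BV β) := by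
      calc NH * Bl β * B6.c1 d δ₀ α * (1 - N' * (B₀ * Real.exp (δ₀ * ρ) * (κ.kP + κ.kC)) * B6.c1 d δ₀ α)⁻¹
          ≤ NH * Bl β * B6.c1 d δ₀ α * 2 := mul_le_mul_of_nonneg_left hinv hA0
        _ = 2 * NH * Bl β * B6.c1 d δ₀ α := by ring
        _ ≤ holderConst d δ₀ α NH N' C (Bl β) (BV β) := by
            unfold holderConst
            have h0 : 0 ≤ NH * Bl β + N' * BV β * C * B6.c1 d δ₀ α :=
              add_nonneg (mul_nonneg hNH hb) (mul_nonneg (mul_nonneg (mul_nonneg hN' hv) hC) hc1)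
            linarith
    exact mul_le_mul (mul_le_mul_of_nonneg_right h1 (hW a)) (hexp a b) (Real.exp_nonneg _) (mul_nonneg hK (hW a))
  · have h1 : NH * Bl β + N' * BV β * C * B6.c1 d δ₀ α ≤ holderConst d δ₀ α NH N' C (Bl β) (BV β) := by
      unfold holderConst
      have h5 : 0 ≤ 2 * NH * Bl β * B6.c1 d δ₀ α := by positivity
      linarith
    exact mul_le_mul_of_nonneg_right (mul_le_mul_of_nonneg_right h1 (hW a)) (Real.exp_nonneg _)

end GpSide

end

end Literature.MathematicalPhysics.QuantumFieldTheory.Balaban1983to89.B9RWSums343HolderGpDir
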